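/-
Copyright (c) 2026 the pub-hodgecm-mathlib formalisation cell (harness21).  Prover seat hodgecm-mathlib-K2E1-p14 (g5), R90-TF section S8 «ContSpec-n½» (dealer R90-CS-plan (g4),
S8-R254 (3) «`R90S8ResGMidAtomAveragedDatumOfRegularU3 :: hAVG_of_regular`» = the letter (hAVG) of ★ p865069 `hFIN_of_levelIdempotents` PAID for REGULAR data, hypothesis-first on
the joint-continuity ∕ local-boundedness letters `hE4` ∕ `hEbd` of the continued family `Ec` in the same bytes as ★ LH4-p10 (g9)'s p865022 `admissible_rightAverage`): the average
over a τ-level `U₀` of a residue generator with a regular continuation datum IS a residue generator of level `ι_f(U₀)`, whence (hFIN) for regular data.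
-/
import Summits.HodgeConjecture.HodgeConjecture.Theorems.R90S8ResGMidAtomGenKTypeProjectionU3    -- ★ p865022 (LH4-p10 (g9)): `admissible_rightAverage` (the averaged datum: section, continuity, holomorphy, `E`-identity, pole letter)
import Summits.HodgeConjecture.HodgeConjecture.Theorems.R90S8ResGMidAtomFiniteAdelicSmoothingU3  -- ★ p865069 (this seat): `hFIN_of_approximants`, `isTauLevel_finCongruenceLevel`, `continuous_rightRegular_finAdelicToAdelic_apply`
import Summits.HodgeConjecture.HodgeConjecture.Theorems.R90S8ResGMidAtomArchStableU3          -- ★ p862999 (K2E1-p11): `midPoleLetter_apply_quotientSubgroup_mul` (left `G(F)`-invariance of `g ↦ Fp g (3/2)`)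
import Summits.HodgeConjecture.HodgeConjecture.Theorems.R90S8ResGMidAtomFlatReexpansionU3      -- ★ (LH4-p10): `borelHeight_mul_finAdelicToAdelic_of_mem_integralLevel` (`H(x·ι_f u) = H(x)`, `u` integral)
import Literature.NumberTheory.Automorphic.AutomorphicFormsL2InvariantAverage                  -- ★ `coeFn_integral_rightRegular_toLp_eq_average` (the class of `∫ R(c s)[F] dρ` is `y ↦ ∫ F(c(s)⁻¹•y) dρ`)
import Literature.NumberTheory.Automorphic.UnitaryGroupAdelicProductHaar                       -- ★ `secondCountableTopology_finAdelic`
import Mathlib.MeasureTheory.Measure.Haar.Basic                                                -- Mathlib `haarMeasure`, `haarMeasure_self` (Haar probability on a compact group)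
import HarnessLib

/-!
# R90·S8 — `R90S8ResGMidAtomAveragedDatumOfRegularU3`: THE `U₀`-AVERAGE OF A REGULAR RESIDUE DATUM IS A DATUM OF LEVEL `ι_f(U₀)`; (hAVG) AND (hFIN) FOR REGULAR DATA

Cell `pub/hodgecm-mathlib`, crux h413 = `stmt-HodgeConjecture-24833`, route of record `HCCMUnconditional`; R90-TF section S8 «ContSpec-n½», the finite half (hFIN) of R90-CS-p03 (g4)'s
`hW1_of_tauStable` (census `R90/S8/CENSUS-hW1-TauStable.R90-CS-p03-g4.md` clause (2)).  THEOREMS ONLY (no `def`, no `instance`, no notation, no named-fact hypothesis, no `sorry`;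
default heartbeats); lane `--supports stmt-HodgeConjecture-24833 --as helper` (count-neutral).  Closes no socket.

THE MATHEMATICS ([MoeglinWaldspurger1995] I.2.17, II.1.5, IV.1.11, V.3.13; [BorelJacquet1979] §4.1, §4.6; [Folland1995] §2.2, §3.2; [Rogawski1990] §13.9 p. 229 (ii)).  ★ p865069
reduced (hFIN) «`resGMidAtom ξ μω ⊥ 1 ≤ closure ⨆_{U₀ τ-level} resGMidAtom ξ μω (ι_f U₀) 1`» to ONE letter (hAVG): the level average of a level-free residue generator is a τ-level atom
vector.  Here (hAVG) is PAID for every generator admitting a REGULAR continuation datum — `g ↦ Ec z g` continuous for `z ∈ {1 < Re} ∖ Sp` (`hE4`) and `Ec` locally bounded on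
`({1 < Re} ∖ Sp) × compacta` (`hEbd`), the letters of ★ `admissible_rightAverage` — by averaging over the COMPACT GROUP `K := ↥U₀` with a left-invariant probability measure `μ_K`
(Haar; any such measure): `P_{U₀} f := ∫_{U₀} R(ι_f k) f dμ_K(k)`.
* THE AVERAGED DATUM (§1): ★ `admissible_rightAverage` (parameter space `↥U₀`, `ι := ι_f ∘ incl`, weight `1`; Borel heights are `ι_f(U₀)`-invariant since `U₀ ≤ G(𝒪̂)_f` ★; the
  input level is immaterial — every section is a level-`⊥` section) supplies the averaged section `P φ = ∫ φ(·ι_f k) dμ_K`, its continuity, the holomorphy of the averaged family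
  `P Ec`, the Eisenstein identity on `{2 < Re}` and an averaged pole letter `Fp'` with `Fp' g (3/2) = ∫ Fp (g ι_f k) (3/2) dμ_K`.  LEVEL RAISING: `P φ` is RIGHT-`ι_f(U₀)`-INVARIANT by
  the left invariance of `μ_K` (`∫ φ(g ι_f(b k)) dμ_K(k) = ∫ φ(g ι_f k) dμ_K(k)`), so `P φ ∈ V(χ₁, χ₂; ι_f(U₀), 1)`.  CLASS: by ★ `coeFn_integral_rightRegular_toLp_eq_average` applied to the
  REPRESENTATIVE `x ↦ Fp((out x)⁻¹)(3/2)` of `f`, the class of `P_{U₀} f` is `y ↦ ∫ Fp((out((ι_f k)⁻¹ • y))⁻¹)(3/2) dμ_K`; the residue function `g ↦ Fp g (3/2)` is left-`G(F)`-invariant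
  (★ `midPoleLetter_apply_quotientSubgroup_mul`, identity theorem), so ★ `quotFun_rightTranslation` turns the integrand into `Fp((out y)⁻¹ ι_f k)(3/2)`, i.e. the class is
  `y ↦ Fp'((out y)⁻¹)(3/2)` — a D1 generator of level `(ι_f(U₀), 1)` (**`average_mem_resGMidAtomGen_tauLevel_of_regular`**).
* THE APPROXIMATE IDENTITY for these averages (§2, Dirac estimate on a probability space + ★ level basis `K_f(𝔫) → 1` + strong continuity of `R`): `‖f − P_{K_f(𝔫)} f‖ < ε`.
* HEADS (§3): **`hAVG_of_regular`** (the (hAVG) letter for regular data, over all τ-levels, for any family of left-invariant probability measures), **`hFIN_of_regular`** =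
  ★ `hFIN_of_approximants` ∘ §2 ∘ `hAVG_of_regular`, and **`hFIN_of_regular_haar`** with the measure family DISCHARGED (`exists_haarProbability_tauLevels`: Haar probability on each
  compact `↥U₀`): IF every level-free residue generator admits a regular datum THEN (hFIN).  The wild residue (generators with no regular datum) is R90-CS-p03 (g4)'s `hW1_wild`.
HONEST LABEL: HC_CM is proved only modulo the 7 printed citations (2 remaining named inputs: hLiu418 = `stmt-HodgeConjecture-24832`, h413 = `stmt-HodgeConjecture-24833`) until rung 0
closes; REL ≠ ★ ≠ BUILT; this file asserts no named fact and closes no socket; after it (hFIN) = ★ for REGULAR data (the regularity letters `hE4` ∕ `hEbd` of ★ p865022 are its only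
hypotheses besides unitarity of `μω`), L at wild data; count-neutral.

## References
* [MoeglinWaldspurger1995] C. Mœglin, J.-L. Waldspurger, *Spectral Decomposition and Eisenstein Series* (1995): I.2.17, II.1.5, IV.1.11, V.3.13.
* [BorelJacquet1979] A. Borel, H. Jacquet, *Automorphic forms and automorphic representations*, Corvallis PSPM 33.1 (1979): §4.1, §4.6.
* [Folland1995] G. B. Folland, *A Course in Abstract Harmonic Analysis* (1995): §2.2 (Haar measure), §3.2 (averaging operators).
* [Rogawski1990] J. D. Rogawski, *Automorphic Representations of Unitary Groups in Three Variables*, Ann. of Math. Stud. 123 (1990): §13.9 p. 229 (ii).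
* [DeitmarEchterhoff2014] A. Deitmar, S. Echterhoff, *Principles of Harmonic Analysis*, 2nd ed. (2014): Lemma 6.2.2 (the Dirac estimate).
-/

set_option autoImplicit false
set_option linter.dupNamespace false  -- the mandated namespace `…HodgeConjecture.HodgeConjecture.R90.S8` repeats the summit's segment

noncomputable section

open MeasureTheory Measure Set Filter Topology TopologicalSpace NumberField
open Literature.NumberTheory Literature.NumberTheory.Automorphic Literature.NumberTheory.Automorphic.UnitaryGroup Literature.NumberTheory.GaloisRepresentations AdelicGroupData
open Literature.NumberTheory.Automorphic.Arthur2013.Leaves.TECR Literature.NumberTheory.Rogawski1990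
open Summit.HodgeConjecture.HodgeConjecture.Cruxes.H413.K2E1BorelEisensteinU
open Summit.HodgeConjecture.HodgeConjecture.Cruxes.H413.K2E1CharacterEisensteinU3PairDefs
open Summit.HodgeConjecture.HodgeConjecture.Cruxes.H413.K2E1ChiSectionSpaceU3PairDefs
open scoped ENNReal NNReal

namespace Summit.HodgeConjecture.HodgeConjecture.R90.S8

/-! ## §0 The Dirac estimate on a probability space -/

/-- **Dirac estimate (probability form)**: if `‖F k − v‖ ≤ ε` for all `k` and `F` is integrable for a probability measure `ρ`, then `‖v − ∫ F dρ‖ ≤ ε` (`v − ∫ F = ∫ (v − F k) dρ(k)`).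
[cite: DeitmarEchterhoff2014, Lemma 6.2.2] -/
theorem norm_sub_integral_le_of_forall_norm_sub_le {K V : Type*} [MeasurableSpace K] (ρ : Measure K) [IsProbabilityMeasure ρ] [NormedAddCommGroup V] [NormedSpace ℝ V] [CompleteSpace V]
    {F : K → V} (hF : Integrable F ρ) (v : V) {ε : ℝ} (h : ∀ k, ‖F k - v‖ ≤ ε) : ‖v - ∫ k, F k ∂ρ‖ ≤ ε := by
  have h1 : v - ∫ k, F k ∂ρ = ∫ k, (v - F k) ∂ρ := by
    rw [integral_sub (integrable_const v) hF, integral_const, probReal_univ, one_smul]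
  rw [h1]
  calc ‖∫ k, (v - F k) ∂ρ‖ ≤ ε * ρ.real univ := norm_integral_le_of_norm_le_const (Eventually.of_forall fun k => by rw [norm_sub_rev]; exact h k)
    _ = ε := by rw [probReal_univ, mul_one]

section Averaging

variable (L : Type) [Field L] [NumberField L] [IsCMField L]
  (μ : Measure (quasiSplit (↥(maximalRealSubfield L)) L (IsCMField.complexConj L) 3).automorphicQuotient)

/-! ## §1 Level raising by a left-invariant average over `U₀`, and the averaged datum of a regular generator -/

variable [MeasurableSpace ↥(finAdelic (↥(maximalRealSubfield L)) L (IsCMField.complexConj L) 3 ((StdForm.antidiagonal 3).over L))]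
  [BorelSpace ↥(finAdelic (↥(maximalRealSubfield L)) L (IsCMField.complexConj L) 3 ((StdForm.antidiagonal 3).over L))]

/-- **LEVEL RAISING**: for a left-invariant measure `μ_K` on `↥U₀`, the average `x ↦ ∫ φ(x · ι_f k) dμ_K(k)` of ANY `(χ₁, χ₂)`-pair section (of any level) is a `(χ₁, χ₂)`-pair section
of level `(ι_f(U₀), 1)`: the Borel law is a left law (★ `isChiSectionPair_rightAverage`), and for `b ∈ U₀`, `∫ φ(g · ι_f b · ι_f k) dμ_K(k) = ∫ φ(g · ι_f(b k)) dμ_K(k) = ∫ φ(g · ι_f k) dμ_K(k)`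
(`integral_mul_left_eq_self`). [cite: MoeglinWaldspurger1995, I.2.17] [cite: BorelJacquet1979, §4.1] [cite: Folland1995, §2.2] -/
theorem rightAverage_mem_chiSectionSpacePair_tauLevel {χ₁ : HeckeCharacter L} {χ₂ : ↥(TorusDict.torus (IsCMField.complexConj L)) →ₜ* ℂˣ}
    {U₀ : Subgroup ↥(finAdelic (↥(maximalRealSubfield L)) L (IsCMField.complexConj L) 3 ((StdForm.antidiagonal 3).over L))} (μK : Measure ↥U₀) [μK.IsMulLeftInvariant]
    {K' : Subgroup (quasiSplit (↥(maximalRealSubfield L)) L (IsCMField.complexConj L) 3).Adelic} {ω : ↥K' → ℂ}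
    {φ : (quasiSplit (↥(maximalRealSubfield L)) L (IsCMField.complexConj L) 3).Adelic → ℂ} (hφV : φ ∈ chiSectionSpacePair χ₁ χ₂ K' ω) :
    (fun x => ∫ k : ↥U₀, φ (x * finAdelicToAdelic (↥(maximalRealSubfield L)) L (IsCMField.complexConj L) 3 ((StdForm.antidiagonal 3).over L)
        (k : ↥(finAdelic (↥(maximalRealSubfield L)) L (IsCMField.complexConj L) 3 ((StdForm.antidiagonal 3).over L)))) ∂μK) ∈
      chiSectionSpacePair χ₁ χ₂ (tauLevel L U₀) ((1 : ↥(tauLevel L U₀) →* ℂ) : ↥(tauLevel L U₀) → ℂ) := by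
  refine mem_chiSectionSpacePair ?_ fun g k => ?_
  · -- the left (Borel) law: ★ `isChiSectionPair_rightAverage` with weight `1`
    have h := isChiSectionPair_rightAverage L μK (fun k : ↥U₀ => finAdelicToAdelic (↥(maximalRealSubfield L)) L (IsCMField.complexConj L) 3 ((StdForm.antidiagonal 3).over L)
      (k : ↥(finAdelic (↥(maximalRealSubfield L)) L (IsCMField.complexConj L) 3 ((StdForm.antidiagonal 3).over L)))) (fun _ => (1 : ℂ)) (isChiSectionPair_of_mem hφV)
    simp only [one_mul] at h
    exact h
  · -- the right law at level `ι_f(U₀)`, character `1`: left invariance of `μ_K`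
    obtain ⟨b, hb, hbk⟩ := (mem_tauLevel_iff L U₀ (k : (quasiSplit (↥(maximalRealSubfield L)) L (IsCMField.complexConj L) 3).Adelic)).1 k.2
    rw [MonoidHom.one_apply, one_mul, ← hbk]
    have h := integral_mul_left_eq_self (μ := μK)
      (fun k' : ↥U₀ => φ (g * finAdelicToAdelic (↥(maximalRealSubfield L)) L (IsCMField.complexConj L) 3 ((StdForm.antidiagonal 3).over L)
        (k' : ↥(finAdelic (↥(maximalRealSubfield L)) L (IsCMField.complexConj L) 3 ((StdForm.antidiagonal 3).over L))))) ⟨b, hb⟩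
    simp only [Subgroup.coe_mul, map_mul, ← mul_assoc] at h
    exact h

variable [(quasiSplit (↥(maximalRealSubfield L)) L (IsCMField.complexConj L) 3).IsAutomorphicMeasure μ] (ξ : OneDimAutRepH L) (μω : HeckeCharacter L)

/-- **THE AVERAGED DATUM OF A REGULAR GENERATOR — `average_mem_resGMidAtomGen_tauLevel_of_regular`.**  Let `U₀` be a τ-level, `μ_K` a left-invariant probability measure on `↥U₀`, and let
`f ∈ L²` carry a D1 datum `(φ, Ec, Sp, Fp)` of ANY level `(K′, ω)` whose continued family is REGULAR — `hE4` (each `Ec z`, `z ∈ {1 < Re} ∖ Sp`, continuous) and `hEbd` (`Ec` locally bounded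
on `({1 < Re} ∖ Sp) × compacta`), the letters of ★ `admissible_rightAverage`.  Then the average `∫_{U₀} R(ι_f k) f dμ_K(k)` is a D1 GENERATOR of level `(ι_f(U₀), 1)`: its datum is the
★ averaged datum (`P φ`, `P Ec`, `Sp`, `Fp'`), of level `ι_f(U₀)` by `rightAverage_mem_chiSectionSpacePair_tauLevel`, and its class is `y ↦ Fp'((out y)⁻¹)(3/2)` by
★ `coeFn_integral_rightRegular_toLp_eq_average` on the representative `x ↦ Fp((out x)⁻¹)(3/2)`, the left `G(F)`-invariance of `g ↦ Fp g (3/2)` (★ `midPoleLetter_apply_quotientSubgroup_mul`)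
and ★ `quotFun_rightTranslation`. [cite: MoeglinWaldspurger1995, I.2.17, IV.1.11, V.3.13] [cite: BorelJacquet1979, §4.1, §4.6] [cite: Folland1995, §3.2] [cite: Rogawski1990, §13.9 p. 229 (ii)] -/
theorem average_mem_resGMidAtomGen_tauLevel_of_regular (hμω : μω.IsUnitary)
    {U₀ : Subgroup ↥(finAdelic (↥(maximalRealSubfield L)) L (IsCMField.complexConj L) 3 ((StdForm.antidiagonal 3).over L))} (hU₀ : IsTauLevel L U₀)
    (μK : Measure ↥U₀) [IsProbabilityMeasure μK] [μK.IsMulLeftInvariant]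
    {K' : Subgroup (quasiSplit (↥(maximalRealSubfield L)) L (IsCMField.complexConj L) 3).Adelic} {ω : ↥K' → ℂ}
    {φ : (quasiSplit (↥(maximalRealSubfield L)) L (IsCMField.complexConj L) 3).Adelic → ℂ} (hφV : φ ∈ chiSectionSpacePair (ξ.bcη⁻¹ * ξ.bcψ⁻¹ * μω) ξ.ψ K' ω) (hφc : Continuous φ)
    (Ec : ℂ → (quasiSplit (↥(maximalRealSubfield L)) L (IsCMField.complexConj L) 3).Adelic → ℂ) (Sp : Finset ℂ) (hSp : ∀ s ∈ Sp, s.im = 0 ∧ 1 < s.re ∧ s.re ≤ 2)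
    (hol : ∀ g, DifferentiableOn ℂ (fun z => Ec z g) ({z : ℂ | 1 < z.re} \ (↑Sp : Set ℂ)))
    (hE4 : ∀ z ∈ ({z : ℂ | 1 < z.re} \ (↑Sp : Set ℂ)), Continuous (Ec z))
    (hEbd : ∀ z₁ ∈ ({z : ℂ | 1 < z.re} \ (↑Sp : Set ℂ)), ∀ S : Set (quasiSplit (↥(maximalRealSubfield L)) L (IsCMField.complexConj L) 3).Adelic, IsCompact S →
      ∃ V ∈ 𝓝 z₁, ∃ M : ℝ, ∀ z ∈ V, ∀ g ∈ S, ‖Ec z g‖ ≤ M)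
    (hEc2 : ∀ z : ℂ, 2 < z.re → Ec z = eisensteinSeriesU (flatSectionU φ z))
    (Fp : (quasiSplit (↥(maximalRealSubfield L)) L (IsCMField.complexConj L) 3).Adelic → ℂ → ℂ) (hFp : ∀ g, AnalyticAt ℂ (Fp g) ((3 : ℂ) / 2))
    (hFpE : ∀ g, Fp g =ᶠ[𝓝[≠] ((3 : ℂ) / 2)] fun z => (z - (3 : ℂ) / 2) * Ec z g)
    {f : (quasiSplit (↥(maximalRealSubfield L)) L (IsCMField.complexConj L) 3).L2 μ}
    (hae : (f : (quasiSplit (↥(maximalRealSubfield L)) L (IsCMField.complexConj L) 3).automorphicQuotient → ℂ) =ᵐ[μ]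
      fun x => Fp (Quotient.out (x : (quasiSplit (↥(maximalRealSubfield L)) L (IsCMField.complexConj L) 3).Adelic ⧸
        (quasiSplit (↥(maximalRealSubfield L)) L (IsCMField.complexConj L) 3).quotientSubgroup))⁻¹ ((3 : ℂ) / 2)) :
    (∫ k : ↥U₀, ((quasiSplit (↥(maximalRealSubfield L)) L (IsCMField.complexConj L) 3).rightRegular μ)
        (finAdelicToAdelic (↥(maximalRealSubfield L)) L (IsCMField.complexConj L) 3 ((StdForm.antidiagonal 3).over L)
          (k : ↥(finAdelic (↥(maximalRealSubfield L)) L (IsCMField.complexConj L) 3 ((StdForm.antidiagonal 3).over L)))) f ∂μK) ∈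
      resGMidAtomGen L μ ξ μω (tauLevel L U₀) 1 := by
  haveI := secondCountableTopology_finAdelic (↥(maximalRealSubfield L)) L (IsCMField.complexConj L) 3 ((StdForm.antidiagonal 3).over L)
  haveI : CompactSpace ↥U₀ := isCompact_iff_compactSpace.mp hU₀.2.1
  -- the parameter map `ι = ι_f ∘ incl : ↥U₀ → G(𝔸)` and its laws
  set ι : ↥U₀ → (quasiSplit (↥(maximalRealSubfield L)) L (IsCMField.complexConj L) 3).Adelic := fun k =>
    finAdelicToAdelic (↥(maximalRealSubfield L)) L (IsCMField.complexConj L) 3 ((StdForm.antidiagonal 3).over L)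
      (k : ↥(finAdelic (↥(maximalRealSubfield L)) L (IsCMField.complexConj L) 3 ((StdForm.antidiagonal 3).over L))) with hι_def
  have hι : Continuous ι :=
    (continuous_finAdelicToAdelic (↥(maximalRealSubfield L)) L (IsCMField.complexConj L) 3 ((StdForm.antidiagonal 3).over L)).comp continuous_subtype_val
  have hH : ∀ (x : (quasiSplit (↥(maximalRealSubfield L)) L (IsCMField.complexConj L) 3).Adelic) (k : ↥U₀), borelHeight (x * ι k) = borelHeight x := fun x k =>
    borelHeight_mul_finAdelicToAdelic_of_mem_integralLevel (hU₀.2.2 k.2) x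
  -- every section is a section of level `⊥`, where the commutation hypothesis of ★ `admissible_rightAverage` is vacuous
  have hφbot : φ ∈ chiSectionSpacePair (ξ.bcη⁻¹ * ξ.bcψ⁻¹ * μω) ξ.ψ (⊥ : Subgroup (quasiSplit (↥(maximalRealSubfield L)) L (IsCMField.complexConj L) 3).Adelic)
      ((1 : ↥(⊥ : Subgroup (quasiSplit (↥(maximalRealSubfield L)) L (IsCMField.complexConj L) 3).Adelic) →* ℂ) :
        ↥(⊥ : Subgroup (quasiSplit (↥(maximalRealSubfield L)) L (IsCMField.complexConj L) 3).Adelic) → ℂ) :=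
    mem_chiSectionSpacePair (isChiSectionPair_of_mem hφV) fun g k => by
      rw [show (k : (quasiSplit (↥(maximalRealSubfield L)) L (IsCMField.complexConj L) 3).Adelic) = 1 from Subgroup.mem_bot.mp k.2, mul_one, MonoidHom.one_apply, one_mul]
  have hcomm : ∀ (k : ↥U₀) (k' : ↥(⊥ : Subgroup (quasiSplit (↥(maximalRealSubfield L)) L (IsCMField.complexConj L) 3).Adelic)),
      ι k * (k' : (quasiSplit (↥(maximalRealSubfield L)) L (IsCMField.complexConj L) 3).Adelic) = (k' : (quasiSplit (↥(maximalRealSubfield L)) L (IsCMField.complexConj L) 3).Adelic) * ι k :=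
    fun k k' => by
      rw [show (k' : (quasiSplit (↥(maximalRealSubfield L)) L (IsCMField.complexConj L) 3).Adelic) = 1 from Subgroup.mem_bot.mp k'.2, mul_one, one_mul]
  -- ★ LH4-p10's admissible right average with weight `1`: continuity, holomorphy, the Eisenstein identity, the averaged pole letter
  obtain ⟨-, hPc, hPhol, hPE2, Fp', hFp', hFp'E, hFp'val⟩ :=
    admissible_rightAverage L μK ι (fun _ => (1 : ℂ)) hι continuous_const hH ξ hμω hcomm hφbot hφc Ec Sp hol hE4 hEbd hEc2 Fp hFp hFpE
  simp only [one_mul] at hPc hPhol hPE2 hFp'E hFp'val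
  -- the residue function `g ↦ Fp g (3/2)` is left-`G(F)`-invariant (identity theorem, ★)
  have hinv : ∀ γ ∈ (quasiSplit (↥(maximalRealSubfield L)) L (IsCMField.complexConj L) 3).quotientSubgroup, ∀ g : (quasiSplit (↥(maximalRealSubfield L)) L (IsCMField.complexConj L) 3).Adelic,
      (fun g : (quasiSplit (↥(maximalRealSubfield L)) L (IsCMField.complexConj L) 3).Adelic => Fp g ((3 : ℂ) / 2)) (γ * g) =
        (fun g : (quasiSplit (↥(maximalRealSubfield L)) L (IsCMField.complexConj L) 3).Adelic => Fp g ((3 : ℂ) / 2)) g :=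
    midPoleLetter_apply_quotientSubgroup_mul L (isChiSectionPair_of_mem hφV) ξ.hψ (fun s hs => (hSp s hs).1) hol hEc2 (by norm_num) (by norm_num) hFp hFpE
  -- the class of the average: ★ `coeFn_integral_rightRegular_toLp_eq_average` on the representative `x ↦ Fp((out x)⁻¹)(3/2)` of `f`
  have hF0 : MemLp (fun x : (quasiSplit (↥(maximalRealSubfield L)) L (IsCMField.complexConj L) 3).automorphicQuotient =>
      Fp (Quotient.out (x : (quasiSplit (↥(maximalRealSubfield L)) L (IsCMField.complexConj L) 3).Adelic ⧸
        (quasiSplit (↥(maximalRealSubfield L)) L (IsCMField.complexConj L) 3).quotientSubgroup))⁻¹ ((3 : ℂ) / 2)) 2 μ :=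
    (Lp.memLp f).ae_eq hae
  have htoLp : hF0.toLp _ = f := Lp.ext (hF0.coeFn_toLp.trans hae.symm)
  have hcU : Continuous ((finAdelicToAdelic (↥(maximalRealSubfield L)) L (IsCMField.complexConj L) 3 ((StdForm.antidiagonal 3).over L)).comp U₀.subtype) := hι
  have hclass := coeFn_integral_rightRegular_toLp_eq_average (quasiSplit (↥(maximalRealSubfield L)) L (IsCMField.complexConj L) 3) μ μK hcU hF0
  rw [htoLp] at hclass
  refine ⟨fun x => ∫ k, φ (x * ι k) ∂μK, rightAverage_mem_chiSectionSpacePair_tauLevel L μK hφV, hPc, fun z g => ∫ k, Ec z (g * ι k) ∂μK, Sp, hSp, hPhol, hPE2,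
    Fp', hFp', hFp'E, hclass.trans (Eventually.of_forall fun y => ?_)⟩
  show (∫ k : ↥U₀, (fun x : (quasiSplit (↥(maximalRealSubfield L)) L (IsCMField.complexConj L) 3).automorphicQuotient =>
      Fp (Quotient.out (x : (quasiSplit (↥(maximalRealSubfield L)) L (IsCMField.complexConj L) 3).Adelic ⧸
        (quasiSplit (↥(maximalRealSubfield L)) L (IsCMField.complexConj L) 3).quotientSubgroup))⁻¹ ((3 : ℂ) / 2)) ((ι k)⁻¹ • y) ∂μK) =
    Fp' (Quotient.out (y : (quasiSplit (↥(maximalRealSubfield L)) L (IsCMField.complexConj L) 3).Adelic ⧸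
      (quasiSplit (↥(maximalRealSubfield L)) L (IsCMField.complexConj L) 3).quotientSubgroup))⁻¹ ((3 : ℂ) / 2)
  rw [hFp'val]
  exact integral_congr_ae (Eventually.of_forall fun k =>
    (congrFun (AdelicGroupData.quotFun_rightTranslation (φ := fun g : (quasiSplit (↥(maximalRealSubfield L)) L (IsCMField.complexConj L) 3).Adelic => Fp g ((3 : ℂ) / 2)) hinv (ι k)) y).symm)

/-- Corollary: the average lies in the τ-level ATOM `resGMidAtom ξ μω (ι_f U₀) 1` (★ `mem_resGMidAtom_of_mem_gen`). [cite: MoeglinWaldspurger1995, V.3.13] [cite: Rogawski1990, §13.9 p. 229 (ii)] -/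
theorem average_mem_resGMidAtom_tauLevel_of_regular (hμω : μω.IsUnitary)
    {U₀ : Subgroup ↥(finAdelic (↥(maximalRealSubfield L)) L (IsCMField.complexConj L) 3 ((StdForm.antidiagonal 3).over L))} (hU₀ : IsTauLevel L U₀)
    (μK : Measure ↥U₀) [IsProbabilityMeasure μK] [μK.IsMulLeftInvariant]
    {K' : Subgroup (quasiSplit (↥(maximalRealSubfield L)) L (IsCMField.complexConj L) 3).Adelic} {ω : ↥K' → ℂ}
    {φ : (quasiSplit (↥(maximalRealSubfield L)) L (IsCMField.complexConj L) 3).Adelic → ℂ} (hφV : φ ∈ chiSectionSpacePair (ξ.bcη⁻¹ * ξ.bcψ⁻¹ * μω) ξ.ψ K' ω) (hφc : Continuous φ)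
    (Ec : ℂ → (quasiSplit (↥(maximalRealSubfield L)) L (IsCMField.complexConj L) 3).Adelic → ℂ) (Sp : Finset ℂ) (hSp : ∀ s ∈ Sp, s.im = 0 ∧ 1 < s.re ∧ s.re ≤ 2)
    (hol : ∀ g, DifferentiableOn ℂ (fun z => Ec z g) ({z : ℂ | 1 < z.re} \ (↑Sp : Set ℂ)))
    (hE4 : ∀ z ∈ ({z : ℂ | 1 < z.re} \ (↑Sp : Set ℂ)), Continuous (Ec z))
    (hEbd : ∀ z₁ ∈ ({z : ℂ | 1 < z.re} \ (↑Sp : Set ℂ)), ∀ S : Set (quasiSplit (↥(maximalRealSubfield L)) L (IsCMField.complexConj L) 3).Adelic, IsCompact S →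
      ∃ V ∈ 𝓝 z₁, ∃ M : ℝ, ∀ z ∈ V, ∀ g ∈ S, ‖Ec z g‖ ≤ M)
    (hEc2 : ∀ z : ℂ, 2 < z.re → Ec z = eisensteinSeriesU (flatSectionU φ z))
    (Fp : (quasiSplit (↥(maximalRealSubfield L)) L (IsCMField.complexConj L) 3).Adelic → ℂ → ℂ) (hFp : ∀ g, AnalyticAt ℂ (Fp g) ((3 : ℂ) / 2))
    (hFpE : ∀ g, Fp g =ᶠ[𝓝[≠] ((3 : ℂ) / 2)] fun z => (z - (3 : ℂ) / 2) * Ec z g)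
    {f : (quasiSplit (↥(maximalRealSubfield L)) L (IsCMField.complexConj L) 3).L2 μ}
    (hae : (f : (quasiSplit (↥(maximalRealSubfield L)) L (IsCMField.complexConj L) 3).automorphicQuotient → ℂ) =ᵐ[μ]
      fun x => Fp (Quotient.out (x : (quasiSplit (↥(maximalRealSubfield L)) L (IsCMField.complexConj L) 3).Adelic ⧸
        (quasiSplit (↥(maximalRealSubfield L)) L (IsCMField.complexConj L) 3).quotientSubgroup))⁻¹ ((3 : ℂ) / 2)) :
    (∫ k : ↥U₀, ((quasiSplit (↥(maximalRealSubfield L)) L (IsCMField.complexConj L) 3).rightRegular μ)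
        (finAdelicToAdelic (↥(maximalRealSubfield L)) L (IsCMField.complexConj L) 3 ((StdForm.antidiagonal 3).over L)
          (k : ↥(finAdelic (↥(maximalRealSubfield L)) L (IsCMField.complexConj L) 3 ((StdForm.antidiagonal 3).over L)))) f ∂μK) ∈
      resGMidAtom L μ ξ μω (tauLevel L U₀) 1 :=
  mem_resGMidAtom_of_mem_gen L μ ξ μω _ _ (average_mem_resGMidAtomGen_tauLevel_of_regular L μ ξ μω hμω hU₀ μK hφV hφc Ec Sp hSp hol hE4 hEbd hEc2 Fp hFp hFpE hae)

/-! ## §2 The approximate identity for the `U₀`-averages -/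

/-- **`‖f − ∫_{K_f(𝔫)} R(ι_f k) f dμ_K‖ < ε` for `𝔫` deep enough**: the orbit map `u ↦ R(ι_f u) f` is continuous (★), so `{u | ‖R(ι_f u) f − f‖ < ε/2}` is a neighbourhood of `1`, contains some
`K_f(𝔫)`, `𝔫 ≠ 0` (★ `exists_finCongruenceLevel_subset`), a τ-level (★ `isTauLevel_finCongruenceLevel`); on it the Dirac estimate (§0) for the probability measure `μ_K` gives `≤ ε/2`.
[cite: BorelJacquet1979, §4.1, §4.6] [cite: DeitmarEchterhoff2014, Lemma 6.2.2] -/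
theorem exists_isTauLevel_norm_sub_average_lt
    (μK : ∀ U₀ : Subgroup ↥(finAdelic (↥(maximalRealSubfield L)) L (IsCMField.complexConj L) 3 ((StdForm.antidiagonal 3).over L)), Measure ↥U₀)
    (hprob : ∀ U₀ : Subgroup ↥(finAdelic (↥(maximalRealSubfield L)) L (IsCMField.complexConj L) 3 ((StdForm.antidiagonal 3).over L)), IsTauLevel L U₀ → IsProbabilityMeasure (μK U₀))
    (f : (quasiSplit (↥(maximalRealSubfield L)) L (IsCMField.complexConj L) 3).L2 μ) {ε : ℝ} (hε : 0 < ε) :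
    ∃ U₀ : Subgroup ↥(finAdelic (↥(maximalRealSubfield L)) L (IsCMField.complexConj L) 3 ((StdForm.antidiagonal 3).over L)), IsTauLevel L U₀ ∧
      ‖f - ∫ k : ↥U₀, ((quasiSplit (↥(maximalRealSubfield L)) L (IsCMField.complexConj L) 3).rightRegular μ)
        (finAdelicToAdelic (↥(maximalRealSubfield L)) L (IsCMField.complexConj L) 3 ((StdForm.antidiagonal 3).over L)
          (k : ↥(finAdelic (↥(maximalRealSubfield L)) L (IsCMField.complexConj L) 3 ((StdForm.antidiagonal 3).over L)))) f ∂μK U₀‖ < ε := by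
  haveI := secondCountableTopology_finAdelic (↥(maximalRealSubfield L)) L (IsCMField.complexConj L) 3 ((StdForm.antidiagonal 3).over L)
  have hcont := continuous_rightRegular_finAdelicToAdelic_apply L μ f
  -- the neighbourhood `{u | ‖R(ι_f u) f − f‖ < ε/2}` of `1` contains a principal congruence level
  have hV : {u : ↥(finAdelic (↥(maximalRealSubfield L)) L (IsCMField.complexConj L) 3 ((StdForm.antidiagonal 3).over L)) |
      ‖((quasiSplit (↥(maximalRealSubfield L)) L (IsCMField.complexConj L) 3).rightRegular μ)
        (finAdelicToAdelic (↥(maximalRealSubfield L)) L (IsCMField.complexConj L) 3 ((StdForm.antidiagonal 3).over L) u) f - f‖ < ε / 2} ∈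
      𝓝 (1 : ↥(finAdelic (↥(maximalRealSubfield L)) L (IsCMField.complexConj L) 3 ((StdForm.antidiagonal 3).over L))) := by
    refine (isOpen_lt (continuous_norm.comp (hcont.sub continuous_const)) continuous_const).mem_nhds ?_
    show ‖((quasiSplit (↥(maximalRealSubfield L)) L (IsCMField.complexConj L) 3).rightRegular μ)
        (finAdelicToAdelic (↥(maximalRealSubfield L)) L (IsCMField.complexConj L) 3 ((StdForm.antidiagonal 3).over L) 1) f - f‖ < ε / 2
    rw [map_one, map_one, one_apply_eq_self, sub_self, norm_zero]
    exact half_pos hε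
  obtain ⟨𝔫, h𝔫, hsub⟩ := exists_finCongruenceLevel_subset hV
  have hτ := isTauLevel_finCongruenceLevel L h𝔫
  haveI := hprob _ hτ
  refine ⟨_, hτ, lt_of_le_of_lt (norm_sub_integral_le_of_forall_norm_sub_le (μK _) ?_ f fun k => (hsub k.2).le) (half_lt_self hε)⟩
  -- the integrand is continuous of constant norm `‖f‖` on a probability space, hence integrable
  exact (integrable_const ‖f‖).mono' ((hcont.comp continuous_subtype_val).aestronglyMeasurable) (Eventually.of_forall fun k => (norm_rightRegular_apply _ _ _ _).le)

/-! ## §3 HEADS: (hAVG) and (hFIN) for regular data -/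

/-- **HEAD — `hAVG_of_regular`: THE LETTER (hAVG) OF ★ `hFIN_of_levelIdempotents` ∕ ★ `hFIN_of_approximants`, PAID FOR REGULAR DATA.**  For any family `μ_K` of left-invariant probability
measures on the τ-levels (Haar — `exists_haarProbability_tauLevels`): for every τ-level `U₀` and every `f ∈ L²` admitting a level-free D1 datum (★ D1 at `(⊥, 1)`, clauses verbatim) whose
continued family is REGULAR (`hE4`, `hEbd` of ★ `admissible_rightAverage`, inserted after the holomorphy clause), the average `∫_{U₀} R(ι_f k) f dμ_K(k)` lies in the τ-level atom
`resGMidAtom ξ μω (ι_f U₀) 1` (§1). [cite: MoeglinWaldspurger1995, I.2.17, IV.1.11, V.3.13] [cite: BorelJacquet1979, §4.1, §4.6] [cite: Folland1995, §3.2] [cite: Rogawski1990, §13.9 p. 229 (ii)] -/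
theorem hAVG_of_regular (hμω : μω.IsUnitary)
    (μK : ∀ U₀ : Subgroup ↥(finAdelic (↥(maximalRealSubfield L)) L (IsCMField.complexConj L) 3 ((StdForm.antidiagonal 3).over L)), Measure ↥U₀)
    (hprob : ∀ U₀ : Subgroup ↥(finAdelic (↥(maximalRealSubfield L)) L (IsCMField.complexConj L) 3 ((StdForm.antidiagonal 3).over L)), IsTauLevel L U₀ → IsProbabilityMeasure (μK U₀))
    (hinv : ∀ U₀ : Subgroup ↥(finAdelic (↥(maximalRealSubfield L)) L (IsCMField.complexConj L) 3 ((StdForm.antidiagonal 3).over L)), IsTauLevel L U₀ → (μK U₀).IsMulLeftInvariant) :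
    ∀ U₀ : Subgroup ↥(finAdelic (↥(maximalRealSubfield L)) L (IsCMField.complexConj L) 3 ((StdForm.antidiagonal 3).over L)), IsTauLevel L U₀ →
      ∀ f : (quasiSplit (↥(maximalRealSubfield L)) L (IsCMField.complexConj L) 3).L2 μ,
        (∃ (φ : (quasiSplit (↥(maximalRealSubfield L)) L (IsCMField.complexConj L) 3).Adelic → ℂ)
          (_ : φ ∈ chiSectionSpacePair (ξ.bcη⁻¹ * ξ.bcψ⁻¹ * μω) ξ.ψ (⊥ : Subgroup (quasiSplit (↥(maximalRealSubfield L)) L (IsCMField.complexConj L) 3).Adelic)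
            ((1 : ↥(⊥ : Subgroup (quasiSplit (↥(maximalRealSubfield L)) L (IsCMField.complexConj L) 3).Adelic) →* ℂ) :
              ↥(⊥ : Subgroup (quasiSplit (↥(maximalRealSubfield L)) L (IsCMField.complexConj L) 3).Adelic) → ℂ)) (_ : Continuous φ)
          (Ec : ℂ → (quasiSplit (↥(maximalRealSubfield L)) L (IsCMField.complexConj L) 3).Adelic → ℂ) (Sp : Finset ℂ)
          (_ : ∀ s ∈ Sp, s.im = 0 ∧ 1 < s.re ∧ s.re ≤ 2)
          (_ : ∀ g, DifferentiableOn ℂ (fun z => Ec z g) ({z : ℂ | 1 < z.re} \ (↑Sp : Set ℂ)))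
          (_ : ∀ z ∈ ({z : ℂ | 1 < z.re} \ (↑Sp : Set ℂ)), Continuous (Ec z))
          (_ : ∀ z₁ ∈ ({z : ℂ | 1 < z.re} \ (↑Sp : Set ℂ)), ∀ S : Set (quasiSplit (↥(maximalRealSubfield L)) L (IsCMField.complexConj L) 3).Adelic, IsCompact S →
            ∃ V ∈ 𝓝 z₁, ∃ M : ℝ, ∀ z ∈ V, ∀ g ∈ S, ‖Ec z g‖ ≤ M)
          (_ : ∀ z : ℂ, 2 < z.re → Ec z = eisensteinSeriesU (flatSectionU φ z))
          (Fp : (quasiSplit (↥(maximalRealSubfield L)) L (IsCMField.complexConj L) 3).Adelic → ℂ → ℂ)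
          (_ : ∀ g, AnalyticAt ℂ (Fp g) ((3 : ℂ) / 2))
          (_ : ∀ g, Fp g =ᶠ[𝓝[≠] ((3 : ℂ) / 2)] fun z => (z - (3 : ℂ) / 2) * Ec z g),
          (f : (quasiSplit (↥(maximalRealSubfield L)) L (IsCMField.complexConj L) 3).automorphicQuotient → ℂ) =ᵐ[μ]
            fun x => Fp (Quotient.out (x : (quasiSplit (↥(maximalRealSubfield L)) L (IsCMField.complexConj L) 3).Adelic ⧸
              (quasiSplit (↥(maximalRealSubfield L)) L (IsCMField.complexConj L) 3).quotientSubgroup))⁻¹ ((3 : ℂ) / 2)) →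
        (∫ k : ↥U₀, ((quasiSplit (↥(maximalRealSubfield L)) L (IsCMField.complexConj L) 3).rightRegular μ)
            (finAdelicToAdelic (↥(maximalRealSubfield L)) L (IsCMField.complexConj L) 3 ((StdForm.antidiagonal 3).over L)
              (k : ↥(finAdelic (↥(maximalRealSubfield L)) L (IsCMField.complexConj L) 3 ((StdForm.antidiagonal 3).over L)))) f ∂μK U₀) ∈
          resGMidAtom L μ ξ μω (tauLevel L U₀) 1 := by
  intro U₀ hU₀ f hf
  obtain ⟨φ, hφV, hφc, Ec, Sp, hSp, hol, hE4, hEbd, hEc2, Fp, hFp, hFpE, hae⟩ := hf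
  haveI := hprob U₀ hU₀
  haveI := hinv U₀ hU₀
  exact average_mem_resGMidAtom_tauLevel_of_regular L μ ξ μω hμω hU₀ (μK U₀) hφV hφc Ec Sp hSp hol hE4 hEbd hEc2 Fp hFp hFpE hae

/-- **HEAD — `hFIN_of_regular`: (hFIN) FOR REGULAR DATA** (★ `hFIN_of_approximants` at `P U₀ f := ∫_{U₀} R(ι_f k) f dμ_K(k)`, the approximate identity §2, the letter `hAVG_of_regular`): for
any family `μ_K` of left-invariant probability measures on the τ-levels, IF every level-free residue generator `f ∈ resGMidAtomGen ξ μω ⊥ 1` admits a REGULAR datum (`hreg`; `Ec` is unique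
given `φ` ★, so this is a property of the generator) THEN `resGMidAtom ξ μω ⊥ 1 ≤ (⨆_{U₀ τ-level} resGMidAtom ξ μω (ι_f U₀) 1).topologicalClosure`.
[cite: MoeglinWaldspurger1995, I.2.17, V.3.13] [cite: BorelJacquet1979, §4.1, §4.6] [cite: Folland1995, §3.2] [cite: DeitmarEchterhoff2014, Lemma 6.2.2] -/
theorem hFIN_of_regular (hμω : μω.IsUnitary)
    (μK : ∀ U₀ : Subgroup ↥(finAdelic (↥(maximalRealSubfield L)) L (IsCMField.complexConj L) 3 ((StdForm.antidiagonal 3).over L)), Measure ↥U₀)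
    (hprob : ∀ U₀ : Subgroup ↥(finAdelic (↥(maximalRealSubfield L)) L (IsCMField.complexConj L) 3 ((StdForm.antidiagonal 3).over L)), IsTauLevel L U₀ → IsProbabilityMeasure (μK U₀))
    (hinv : ∀ U₀ : Subgroup ↥(finAdelic (↥(maximalRealSubfield L)) L (IsCMField.complexConj L) 3 ((StdForm.antidiagonal 3).over L)), IsTauLevel L U₀ → (μK U₀).IsMulLeftInvariant)
    (hreg : ∀ f ∈ resGMidAtomGen L μ ξ μω ⊥ 1,
      ∃ (φ : (quasiSplit (↥(maximalRealSubfield L)) L (IsCMField.complexConj L) 3).Adelic → ℂ)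
        (_ : φ ∈ chiSectionSpacePair (ξ.bcη⁻¹ * ξ.bcψ⁻¹ * μω) ξ.ψ (⊥ : Subgroup (quasiSplit (↥(maximalRealSubfield L)) L (IsCMField.complexConj L) 3).Adelic)
          ((1 : ↥(⊥ : Subgroup (quasiSplit (↥(maximalRealSubfield L)) L (IsCMField.complexConj L) 3).Adelic) →* ℂ) :
            ↥(⊥ : Subgroup (quasiSplit (↥(maximalRealSubfield L)) L (IsCMField.complexConj L) 3).Adelic) → ℂ)) (_ : Continuous φ)
        (Ec : ℂ → (quasiSplit (↥(maximalRealSubfield L)) L (IsCMField.complexConj L) 3).Adelic → ℂ) (Sp : Finset ℂ)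
        (_ : ∀ s ∈ Sp, s.im = 0 ∧ 1 < s.re ∧ s.re ≤ 2)
        (_ : ∀ g, DifferentiableOn ℂ (fun z => Ec z g) ({z : ℂ | 1 < z.re} \ (↑Sp : Set ℂ)))
        (_ : ∀ z ∈ ({z : ℂ | 1 < z.re} \ (↑Sp : Set ℂ)), Continuous (Ec z))
        (_ : ∀ z₁ ∈ ({z : ℂ | 1 < z.re} \ (↑Sp : Set ℂ)), ∀ S : Set (quasiSplit (↥(maximalRealSubfield L)) L (IsCMField.complexConj L) 3).Adelic, IsCompact S →
          ∃ V ∈ 𝓝 z₁, ∃ M : ℝ, ∀ z ∈ V, ∀ g ∈ S, ‖Ec z g‖ ≤ M)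
        (_ : ∀ z : ℂ, 2 < z.re → Ec z = eisensteinSeriesU (flatSectionU φ z))
        (Fp : (quasiSplit (↥(maximalRealSubfield L)) L (IsCMField.complexConj L) 3).Adelic → ℂ → ℂ)
        (_ : ∀ g, AnalyticAt ℂ (Fp g) ((3 : ℂ) / 2))
        (_ : ∀ g, Fp g =ᶠ[𝓝[≠] ((3 : ℂ) / 2)] fun z => (z - (3 : ℂ) / 2) * Ec z g),
        (f : (quasiSplit (↥(maximalRealSubfield L)) L (IsCMField.complexConj L) 3).automorphicQuotient → ℂ) =ᵐ[μ]
          fun x => Fp (Quotient.out (x : (quasiSplit (↥(maximalRealSubfield L)) L (IsCMField.complexConj L) 3).Adelic ⧸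
            (quasiSplit (↥(maximalRealSubfield L)) L (IsCMField.complexConj L) 3).quotientSubgroup))⁻¹ ((3 : ℂ) / 2)) :
    resGMidAtom L μ ξ μω ⊥ 1 ≤
      (⨆ (U₀ : Subgroup ↥(finAdelic (↥(maximalRealSubfield L)) L (IsCMField.complexConj L) 3 ((StdForm.antidiagonal 3).over L))) (_ : IsTauLevel L U₀),
        resGMidAtom L μ ξ μω (tauLevel L U₀) 1).topologicalClosure :=
  hFIN_of_approximants L μ ξ μω
    (fun U₀ f => ∫ k : ↥U₀, ((quasiSplit (↥(maximalRealSubfield L)) L (IsCMField.complexConj L) 3).rightRegular μ)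
      (finAdelicToAdelic (↥(maximalRealSubfield L)) L (IsCMField.complexConj L) 3 ((StdForm.antidiagonal 3).over L)
        (k : ↥(finAdelic (↥(maximalRealSubfield L)) L (IsCMField.complexConj L) 3 ((StdForm.antidiagonal 3).over L)))) f ∂μK U₀)
    (fun f _ _ hε => exists_isTauLevel_norm_sub_average_lt L μ μK hprob f hε)
    (fun U₀ hU₀ f hf => hAVG_of_regular L μ ξ μω hμω μK hprob hinv U₀ hU₀ f (hreg f hf))

/-- **The measure family, DISCHARGED**: there is a family `μ_K U₀` of measures on the subgroups `U₀ ≤ U(J₃)(𝔸_{L⁺,f})` which on every τ-level (compact ★) is a left-invariant PROBABILITY measure —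
the normalised Haar measure of the compact group `↥U₀` (Mathlib `haarMeasure ⊤`, `haarMeasure_self`). [cite: Folland1995, §2.2] -/
theorem exists_haarProbability_tauLevels :
    ∃ μK : ∀ U₀ : Subgroup ↥(finAdelic (↥(maximalRealSubfield L)) L (IsCMField.complexConj L) 3 ((StdForm.antidiagonal 3).over L)), Measure ↥U₀,
      ∀ U₀ : Subgroup ↥(finAdelic (↥(maximalRealSubfield L)) L (IsCMField.complexConj L) 3 ((StdForm.antidiagonal 3).over L)), IsTauLevel L U₀ →
        IsProbabilityMeasure (μK U₀) ∧ (μK U₀).IsMulLeftInvariant := by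
  classical
  refine ⟨fun U₀ => if h : IsCompact ((U₀ : Subgroup ↥(finAdelic (↥(maximalRealSubfield L)) L (IsCMField.complexConj L) 3 ((StdForm.antidiagonal 3).over L))) :
      Set ↥(finAdelic (↥(maximalRealSubfield L)) L (IsCMField.complexConj L) 3 ((StdForm.antidiagonal 3).over L))) then
        (haveI : CompactSpace ↥U₀ := isCompact_iff_compactSpace.mp h; haarMeasure ⊤) else 0, fun U₀ hU₀ => ?_⟩
  haveI : CompactSpace ↥U₀ := isCompact_iff_compactSpace.mp hU₀.2.1
  simp only [dif_pos hU₀.2.1]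
  exact ⟨⟨by rw [← PositiveCompacts.coe_top (α := ↥U₀), haarMeasure_self]⟩, inferInstance⟩

/-- **HEAD — `hFIN_of_regular_haar`: (hFIN) FOR REGULAR DATA, NO MEASURE BINDER** (`hFIN_of_regular` at the Haar probability family of `exists_haarProbability_tauLevels`): IF every level-free
residue generator admits a regular datum THEN `resGMidAtom ξ μω ⊥ 1 ≤ (⨆_{U₀ τ-level} resGMidAtom ξ μω (ι_f U₀) 1).topologicalClosure` — the (hFIN) binder of ★ `hW1_of_tauStable` for regular data.
[cite: MoeglinWaldspurger1995, I.2.17, V.3.13] [cite: BorelJacquet1979, §4.1, §4.6] [cite: Folland1995, §2.2, §3.2] -/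
theorem hFIN_of_regular_haar (hμω : μω.IsUnitary)
    (hreg : ∀ f ∈ resGMidAtomGen L μ ξ μω ⊥ 1,
      ∃ (φ : (quasiSplit (↥(maximalRealSubfield L)) L (IsCMField.complexConj L) 3).Adelic → ℂ)
        (_ : φ ∈ chiSectionSpacePair (ξ.bcη⁻¹ * ξ.bcψ⁻¹ * μω) ξ.ψ (⊥ : Subgroup (quasiSplit (↥(maximalRealSubfield L)) L (IsCMField.complexConj L) 3).Adelic)
          ((1 : ↥(⊥ : Subgroup (quasiSplit (↥(maximalRealSubfield L)) L (IsCMField.complexConj L) 3).Adelic) →* ℂ) :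
            ↥(⊥ : Subgroup (quasiSplit (↥(maximalRealSubfield L)) L (IsCMField.complexConj L) 3).Adelic) → ℂ)) (_ : Continuous φ)
        (Ec : ℂ → (quasiSplit (↥(maximalRealSubfield L)) L (IsCMField.complexConj L) 3).Adelic → ℂ) (Sp : Finset ℂ)
        (_ : ∀ s ∈ Sp, s.im = 0 ∧ 1 < s.re ∧ s.re ≤ 2)
        (_ : ∀ g, DifferentiableOn ℂ (fun z => Ec z g) ({z : ℂ | 1 < z.re} \ (↑Sp : Set ℂ)))
        (_ : ∀ z ∈ ({z : ℂ | 1 < z.re} \ (↑Sp : Set ℂ)), Continuous (Ec z))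
        (_ : ∀ z₁ ∈ ({z : ℂ | 1 < z.re} \ (↑Sp : Set ℂ)), ∀ S : Set (quasiSplit (↥(maximalRealSubfield L)) L (IsCMField.complexConj L) 3).Adelic, IsCompact S →
          ∃ V ∈ 𝓝 z₁, ∃ M : ℝ, ∀ z ∈ V, ∀ g ∈ S, ‖Ec z g‖ ≤ M)
        (_ : ∀ z : ℂ, 2 < z.re → Ec z = eisensteinSeriesU (flatSectionU φ z))
        (Fp : (quasiSplit (↥(maximalRealSubfield L)) L (IsCMField.complexConj L) 3).Adelic → ℂ → ℂ)
        (_ : ∀ g, AnalyticAt ℂ (Fp g) ((3 : ℂ) / 2))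
        (_ : ∀ g, Fp g =ᶠ[𝓝[≠] ((3 : ℂ) / 2)] fun z => (z - (3 : ℂ) / 2) * Ec z g),
        (f : (quasiSplit (↥(maximalRealSubfield L)) L (IsCMField.complexConj L) 3).automorphicQuotient → ℂ) =ᵐ[μ]
          fun x => Fp (Quotient.out (x : (quasiSplit (↥(maximalRealSubfield L)) L (IsCMField.complexConj L) 3).Adelic ⧸
            (quasiSplit (↥(maximalRealSubfield L)) L (IsCMField.complexConj L) 3).quotientSubgroup))⁻¹ ((3 : ℂ) / 2)) :
    resGMidAtom L μ ξ μω ⊥ 1 ≤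
      (⨆ (U₀ : Subgroup ↥(finAdelic (↥(maximalRealSubfield L)) L (IsCMField.complexConj L) 3 ((StdForm.antidiagonal 3).over L))) (_ : IsTauLevel L U₀),
        resGMidAtom L μ ξ μω (tauLevel L U₀) 1).topologicalClosure := by
  obtain ⟨μK, hμK⟩ := exists_haarProbability_tauLevels L
  exact hFIN_of_regular L μ ξ μω hμω μK (fun U₀ h => (hμK U₀ h).1) (fun U₀ h => (hμK U₀ h).2) hreg

end Averaging

end Summit.HodgeConjecture.HodgeConjecture.R90.S8

end
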